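import Summits.AtomisticToContinuum.Crystallization.Theorems.FrustratedLawDichotomyExemptLocal

/-!
# FrustratedLawDichotomy · crux `AperiodicFrustratedLawGap` (stmt-AtomisticToContinuum-27623) — THE INCLUSION CHAIN OF THE EXEMPT RESIDUALS
# `FRG♭ ⟹ FRG♭_X^rem ⟹ FRG♭_X^opt` (decomp-a2c, prover hand 2, structural share, generation 14; bookkeeping)

The exempt residuals of `…ExemptRemoval` / `…ExemptLocOpt` are WEAKER than the tree's `SchurRangeGap` (FRG♭) and ordered among themselves:

* `SchurRangeGapX.of_imp` : enlarging the refund predicate (and making the rate nonnegative) weakens `FRG♭_X`;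
* `schurRangeGapX_of_schurRangeGap` : the tree's `SchurRangeGap w ω A e₁ C` gives `SchurRangeGapX w ω A e₁ (max C 0) Ex` for EVERY `Ex`;
* `locOptFails_of_removalUnstable` : for `e⋆ ≤ eUp`, `ε ≤ t`, `0 ≤ ϱ`, `1 ≤ K`, a removal-unstable site (`siteEnergy > eUp + t`) fails
  `(ε, ϱ, K)`-local optimality at `μ = e⋆` (deletion of the single atom: `s = {y_i}`, `R = ∅`);
* `schurRangeGapX_locOpt_of_removal` : hence `FRG♭_X(…, C, RemovalUnstable eUp t) ⟹ FRG♭_X(…, max C 0, LocOptFails e⋆ ε ϱ K)`.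

So the three residual candidates beneath 27623 are nested through proved implications: `FRG♭₄₅ ⟹ FRG♭_X^rem(t) ⟹ FRG♭_X^opt(ε ≤ t, ϱ, K ≥ 1)`,
each feeding the crux by a proved door (`aperiodicFrustratedLawGap_of_schurCut_fourHalf` / `…_removal_fourHalf` / `…_locOpt_fourHalf`).
All `[folklore]` bookkeeping.
-/

noncomputable section

namespace Summit.AtomisticToContinuum.Crystallization.Theorems.FrustratedLawDichotomyExemptChain

open Metric
open Literature.MathematicalPhysics.StatisticalMechanics
open Summit.AtomisticToContinuum.Crystallization.Theorems.ChargedEnergyGapNegative (E3 eStar)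
open Summit.AtomisticToContinuum.Crystallization.Theorems.FrustratedLawDichotomyExemptDoor
open Summit.AtomisticToContinuum.Crystallization.Theorems.FrustratedLawDichotomyGSCClusterExactness
  (tsum_diff_singleton_eq_tsum tsum_range_eq_sum)
open Summit.AtomisticToContinuum.Crystallization.Theorems.FrustratedLawDichotomyExemptRemoval
  (RemovalUnstable removalUnstable_iff sum_eq_siteEnergy SchurRangeGapX)
open Summit.AtomisticToContinuum.Crystallization.Theorems.FrustratedLawDichotomyExemptLocOpt (LocOpt LocOptFails)
open Summit.AtomisticToContinuum.Crystallization.Theorems.FrustratedLawDichotomyRangeCut (Sep GoodAt goodCount)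
open Summit.AtomisticToContinuum.Crystallization.Theorems.FrustratedLawDichotomySchurCut (SchurRangeGap effPot)

/-! ## §1. Monotonicity of `FRG♭_X` in the refund predicate -/

/-- **`FRG♭_X` is monotone in the exemption**: if `Ex ⟹ Ex'` pointwise then `FRG♭_X(e₁, C, Ex) ⟹ FRG♭_X(e₁, max C 0, Ex')`. [folklore] -/
theorem SchurRangeGapX.of_imp {w ω : ℝ → ℝ} {A e₁ C : ℝ} {Ex Ex' : SitePred} (h : SchurRangeGapX w ω A e₁ C Ex)
    (himp : ∀ (N : ℕ) (y : Fin N → EuclideanSpace ℝ (Fin 3)) (i : Fin N), Ex N y i → Ex' N y i) :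
    SchurRangeGapX w ω A e₁ (max C 0) Ex' := by
  classical
  intro N y hy hsep
  have h1 := h N y hy hsep
  have hle : (Nat.card {i : Fin N // GoodAt (1 / 20) y i ∨ Ex N y i} : ℝ) ≤
      Nat.card {i : Fin N // GoodAt (1 / 20) y i ∨ Ex' N y i} := by
    exact_mod_cast Nat.card_le_card_of_injective
      (fun i : {i : Fin N // GoodAt (1 / 20) y i ∨ Ex N y i} =>
        (⟨i.1, i.2.imp_right (himp N y i.1)⟩ : {i : Fin N // GoodAt (1 / 20) y i ∨ Ex' N y i}))
      fun a b hab => Subtype.ext (by simpa using congrArg Subtype.val hab)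
  have hg0 : (0 : ℝ) ≤ Nat.card {i : Fin N // GoodAt (1 / 20) y i ∨ Ex N y i} := Nat.cast_nonneg _
  have hC0 : (0 : ℝ) ≤ max C 0 := le_max_right _ _
  have hCC : C ≤ max C 0 := le_max_left _ _
  nlinarith [mul_le_mul_of_nonneg_left hle hC0, mul_le_mul_of_nonneg_right hCC hg0]

/-- **The tree's FRG♭ implies every exempt FRG♭_X** (refund set enlarged from the good sites to good-or-exempt). [folklore] -/
theorem schurRangeGapX_of_schurRangeGap {w ω : ℝ → ℝ} {A e₁ C : ℝ} (h : SchurRangeGap w ω A e₁ C) (Ex : SitePred) :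
    SchurRangeGapX w ω A e₁ (max C 0) Ex := by
  classical
  have h0 : SchurRangeGapX w ω A e₁ C (fun _ _ _ => False) := by
    intro N y hy hsep
    have h1 := h N y hy hsep
    have heq : (Nat.card {i : Fin N // GoodAt (1 / 20) y i ∨ False} : ℝ) = goodCount (1 / 20) y := by
      simp only [or_false]
      rfl
    rw [heq]
    exact h1
  exact SchurRangeGapX.of_imp h0 fun _ _ _ hf => hf.elim

/-! ## §2. Removal instability is a failure of local optimality -/

/-- **A removal-unstable site is not locally optimal**: for `e⋆ ≤ eUp`, `ε ≤ t`, `0 ≤ ϱ` and `1 ≤ K`, `RemovalUnstable eUp t ⟹ LocOptFails e⋆ ε ϱ K`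
(test Sütő's inequality with `s = {y_i}` deleted and nothing inserted). [folklore] -/
theorem locOptFails_of_removalUnstable {eUp t ε ϱ : ℝ} {K : ℕ} (hUp : eStar ≤ eUp) (hεt : ε ≤ t) (hϱ : 0 ≤ ϱ) (hK : 1 ≤ K)
    {N : ℕ} {y : Fin N → EuclideanSpace ℝ (Fin 3)} (hy : Function.Injective y) {i : Fin N}
    (h : RemovalUnstable eUp t N y i) : LocOptFails eStar ε ϱ K N y i := by
  rw [removalUnstable_iff] at h
  intro hopt
  -- the deleted singleton and the empty competitor
  have hs : Function.Injective (fun _ : Fin 1 => y i) := Function.injective_of_subsingleton _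
  have hsY : Set.range (fun _ : Fin 1 => y i) ⊆ Set.range y := by
    rintro _ ⟨_, rfl⟩; exact ⟨i, rfl⟩
  have hR : Function.Injective (fun l : Fin 0 => (l.elim0 : EuclideanSpace ℝ (Fin 3))) := fun l => l.elim0
  have key := hopt 1 (fun _ => y i) hK hs hsY (fun _ => by rw [dist_self]; exact hϱ) 0
    (fun l : Fin 0 => (l.elim0 : EuclideanSpace ℝ (Fin 3))) (Nat.zero_le K) hR (fun l => l.elim0)
    (by rw [Set.range_eq_empty]; exact Set.empty_disjoint _)
  -- evaluate both sides
  have hU1 : interactionEnergy lennardJones (fun _ : Fin 1 => y i) = 0 := interactionEnergy_of_subsingleton lennardJones _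
  have hU0 : interactionEnergy lennardJones (fun l : Fin 0 => (l.elim0 : EuclideanSpace ℝ (Fin 3))) = 0 :=
    interactionEnergy_of_subsingleton lennardJones _
  have hrange1 : Set.range (fun _ : Fin 1 => y i) = {y i} := by
    ext q; simp
  have hfield : (∑ _l : Fin 1, ∑' q : ↥(Set.range y \ Set.range (fun _ : Fin 1 => y i)), lennardJones (dist (y i) q)) =
      siteEnergy lennardJones y i := by
    rw [Finset.sum_const, Finset.card_univ, Fintype.card_fin, one_smul, hrange1,
      tsum_diff_singleton_eq_tsum lennardJones_zero, tsum_range_eq_sum hy, sum_eq_siteEnergy]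
  have hempty : (∑ l : Fin 0, ∑' q : ↥(Set.range y \ Set.range (fun _ : Fin 1 => y i)),
      lennardJones (dist ((fun l : Fin 0 => (l.elim0 : EuclideanSpace ℝ (Fin 3))) l) q)) = 0 := Fin.sum_univ_zero _
  rw [hU1, hU0, hfield, hempty] at key
  simp only [Nat.cast_one, Nat.cast_zero, mul_one, mul_zero, zero_add, sub_zero] at key
  linarith

/-- **`FRG♭_X^rem ⟹ FRG♭_X^opt`**: the removal-exempt residual implies the local-optimality-exempt one (`e⋆ ≤ eUp`, `ε ≤ t`, `0 ≤ ϱ`, `1 ≤ K`).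
[folklore] -/
theorem schurRangeGapX_locOpt_of_removal {w ω : ℝ → ℝ} {A e₁ C eUp t ε ϱ : ℝ} {K : ℕ} (hUp : eStar ≤ eUp) (hεt : ε ≤ t)
    (hϱ : 0 ≤ ϱ) (hK : 1 ≤ K) (h : SchurRangeGapX w ω A e₁ C (RemovalUnstable eUp t)) :
    SchurRangeGapX w ω A e₁ (max C 0) (LocOptFails eStar ε ϱ K) := by
  classical
  intro N y hy hsep
  have h1 := h N y hy hsep
  have hle : (Nat.card {i : Fin N // GoodAt (1 / 20) y i ∨ RemovalUnstable eUp t N y i} : ℝ) ≤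
      Nat.card {i : Fin N // GoodAt (1 / 20) y i ∨ LocOptFails eStar ε ϱ K N y i} := by
    exact_mod_cast Nat.card_le_card_of_injective
      (fun i : {i : Fin N // GoodAt (1 / 20) y i ∨ RemovalUnstable eUp t N y i} =>
        (⟨i.1, i.2.imp_right (locOptFails_of_removalUnstable hUp hεt hϱ hK hy)⟩ :
          {i : Fin N // GoodAt (1 / 20) y i ∨ LocOptFails eStar ε ϱ K N y i}))
      fun a b hab => Subtype.ext (by simpa using congrArg Subtype.val hab)
  have hg0 : (0 : ℝ) ≤ Nat.card {i : Fin N // GoodAt (1 / 20) y i ∨ RemovalUnstable eUp t N y i} := Nat.cast_nonneg _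
  have hC0 : (0 : ℝ) ≤ max C 0 := le_max_right _ _
  have hCC : C ≤ max C 0 := le_max_left _ _
  nlinarith [mul_le_mul_of_nonneg_left hle hC0, mul_le_mul_of_nonneg_right hCC hg0]

end Summit.AtomisticToContinuum.Crystallization.Theorems.FrustratedLawDichotomyExemptChain

end
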